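import Mathlib.Tactic
import HarnessLib
import HarnessLib.Audit.Tags
import Summits.CriticalPhenomena.PercolationContinuityZ3.Theorems.PercNearOneGluingNoHeavyLowerTailSahiRainbowMaxDual

/-!
# The max-antichain accounting: generic position of the HARD members only

Support file (seat `prim-masterthm-p1`, gen 39; `--supports stmt-CriticalPhenomena-4575`).  Unconditional theorems, no new definitions, no
`sorry`, standard axioms.  Memo `run/shared/lean/prim/prim-masterthm/FROM-prim-masterthm-p1-g39-MAX-ACCOUNTING.md` §8.

SETTING (`…SahiRainbowMax`): `A = maxMembers P`, hard members `X = hardMembers F P ⊆ A` (minimal in `P`, complement not a colour of `A`),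
`availColours`, and the accounting `card_le_card_rainbowMeets_of_avail`.  `card_le_card_rainbowMeets_of_generic` (p588765) asked that NO
maximal member be the complement of a colour of `A` and that NO complemented join of two maximal members lie strictly inside a maximal member.

NEW HERE ([this work], gen 39): only the colours OF THE HARD MEMBERS matter.
* `rainbowMeets_hard_subset_availColours`: if no meet of two hard members is the complement of a maximal member (no hard meet is BLOCKED) and no
  complemented join of two hard members lies strictly inside a NON-hard maximal member (no hard cojoin is SWALLOWED by an outsider), then every
  rainbow meet of `X` is available to `X`.
* **`card_le_card_rainbowMeets_of_hard_generic`** (UNCONDITIONAL): under these two conditions the complement-free family `P` satisfies the rainbow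
  lemma (by the antichain rainbow lemma for `X`, gen 38).  This contains `…_of_generic`, `…_of_no_small_cover` and the families with at most one
  hard member, and has a MIN-antichain twin via `…SahiRainbowMaxDual` (`card_le_card_rainbowMeets_of_hard_generic_compl`).
HONEST FRAMING: unconditional; the general case (`AntichainAvailHall`: blocked hard meets and swallowed hard cojoins) remains OPEN. [this work]
-/

namespace Summit.CriticalPhenomena.PercolationContinuityZ3.Theorems.SahiColouredDaykin

open Finset

variable {α : Type*} [DecidableEq α]

section HardGeneric

variable {F : Finset α} {A X : Finset (Finset α)}

/-- **Unblocked meets and unswallowed cojoins of `X` are available.**  For a complement-free antichain `A`, an admissible `X ⊆ A`, if no meet of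
two members of `X` is the complement of a member of `A` and every member of `A` strictly containing a complemented join of two members of `X`
belongs to `X`, then `rainbowMeets F X ⊆ availColours F A X`. [this work] -/
theorem rainbowMeets_subset_availColours_of_hard_generic (hAF : ∀ a ∈ A, a ⊆ F) (hanti : IsAntichain (· ⊆ ·) (A : Set (Finset α)))
    (hXA : X ⊆ A) (hX : ∀ x ∈ X, F \ x ∉ rainbowMeets F A) (hXne : X.Nonempty)
    (hB : ∀ x ∈ X, ∀ y ∈ X, x ≠ y → F \ (x ∩ y) ∉ A)
    (hS : ∀ x ∈ X, ∀ y ∈ X, x ≠ y → ∀ a ∈ A, F \ (x ∪ y) ⊂ a → a ∈ X) :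
    rainbowMeets F X ⊆ availColours F A X := by
  obtain ⟨x₀, hx₀⟩ := hXne
  have hXF : ∀ S ∈ X, S ⊆ F := fun S hS => hAF S (hXA hS)
  have hXanti : IsAntichain (· ⊆ ·) (X : Set (Finset α)) := hanti.subset (coe_subset.2 hXA)
  intro t ht
  rcases mem_rainbowMeets_iff.1 ht with rfl | ⟨x, hx, y, hy, hxy, rfl | rfl⟩
  · exact empty_mem_availColours hAF hanti hXA hX hx₀
  · refine mem_availColours_iff.2 ⟨inter_mem_rainbowMeets (hXA hx) (hXA hy) hxy, hB x hx y hy hxy, Or.inr ⟨x, hx, ?_⟩⟩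
    refine Finset.ssubset_iff_subset_ne.2 ⟨inter_subset_left, fun e => ?_⟩
    exact hXanti (mem_coe.2 hx) (mem_coe.2 hy) hxy (inter_eq_left.1 e)
  · refine mem_availColours_iff.2 ⟨sdiff_union_mem_rainbowMeets (hXA hx) (hXA hy) hxy, fun hmem => ?_, ?_⟩
    · rw [Finset.sdiff_sdiff_eq_self (union_subset (hXF x hx) (hXF y hy))] at hmem
      have e : x = x ∪ y := by
        by_contra hne
        exact hanti (mem_coe.2 (hXA hx)) (mem_coe.2 hmem) hne subset_union_left
      have : y ⊆ x := by rw [e]; exact subset_union_right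
      exact hXanti (mem_coe.2 hy) (mem_coe.2 hx) (Ne.symm hxy) this
    · by_cases h : ∃ a ∈ A, F \ (x ∪ y) ⊂ a
      · obtain ⟨a, ha, hlt⟩ := h
        exact Or.inr ⟨a, hS x hx y hy hxy a ha hlt, hlt⟩
      · push Not at h
        exact Or.inl h

/-- **The rainbow lemma when the hard members are in generic position** (UNCONDITIONAL): if no meet of two hard members is the complement of a
maximal member and every maximal member strictly containing a complemented join of two hard members is itself hard, then
`#P ≤ #rainbowMeets F P`. [this work] -/
theorem card_le_card_rainbowMeets_of_hard_generic {P : Finset (Finset α)} (hPF : ∀ S ∈ P, S ⊆ F) (hcf : ∀ S ∈ P, F \ S ∉ P)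
    (hB : ∀ x ∈ hardMembers F P, ∀ y ∈ hardMembers F P, x ≠ y → F \ (x ∩ y) ∉ maxMembers P)
    (hS : ∀ x ∈ hardMembers F P, ∀ y ∈ hardMembers F P, x ≠ y → ∀ a ∈ maxMembers P, F \ (x ∪ y) ⊂ a → a ∈ hardMembers F P) :
    #P ≤ #(rainbowMeets F P) := by
  apply card_le_card_rainbowMeets_of_avail hPF hcf
  set A := maxMembers P with hA
  set X := hardMembers F P with hX
  have hAP : A ⊆ P := maxMembers_subset P
  have hXA : X ⊆ A := hardMembers_subset F P
  have hAF : ∀ a ∈ A, a ⊆ F := fun a ha => hPF a (hAP ha)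
  have hXF : ∀ S ∈ X, S ⊆ F := fun S hS => hAF S (hXA hS)
  have hXcf : ∀ S ∈ X, F \ S ∉ X := fun S hS h' => hcf S (hAP (hXA hS)) (hAP (hXA h'))
  have hanti : IsAntichain (· ⊆ ·) (A : Set (Finset α)) := isAntichain_maxMembers P
  have hXanti : IsAntichain (· ⊆ ·) (X : Set (Finset α)) := hanti.subset (coe_subset.2 hXA)
  have hXσ : ∀ x ∈ X, F \ x ∉ rainbowMeets F A := fun x hx => (mem_hardMembers_iff.1 hx).2.2
  rcases X.eq_empty_or_nonempty with hX0 | hXne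
  · rw [hX0, card_empty]; exact Nat.zero_le _
  exact (card_le_card_rainbowMeets_of_antichain F X hXF hXcf hXanti).trans
    (card_le_card (rainbowMeets_subset_availColours_of_hard_generic hAF hanti hXA hXσ hXne hB hS))

/-- The min-antichain twin: the same criterion applied to the complemented family. [this work] -/
theorem card_le_card_rainbowMeets_of_hard_generic_compl {P : Finset (Finset α)} (hPF : ∀ S ∈ P, S ⊆ F) (hcf : ∀ S ∈ P, F \ S ∉ P)
    (hB : ∀ x ∈ hardMembers F (P.image (F \ ·)), ∀ y ∈ hardMembers F (P.image (F \ ·)), x ≠ y →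
      F \ (x ∩ y) ∉ maxMembers (P.image (F \ ·)))
    (hS : ∀ x ∈ hardMembers F (P.image (F \ ·)), ∀ y ∈ hardMembers F (P.image (F \ ·)), x ≠ y →
      ∀ a ∈ maxMembers (P.image (F \ ·)), F \ (x ∪ y) ⊂ a → a ∈ hardMembers F (P.image (F \ ·))) :
    #P ≤ #(rainbowMeets F P) :=
  card_le_card_rainbowMeets_of_image_compl hPF
    (card_le_card_rainbowMeets_of_hard_generic subset_of_mem_image_compl (image_compl_complFree hPF hcf) hB hS)

end HardGeneric

end Summit.CriticalPhenomena.PercolationContinuityZ3.Theorems.SahiColouredDaykin
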